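import Literature.AlgebraicGeometry.Motives.SeesawRelativeChartSections
import Mathlib.AlgebraicGeometry.IdealSheaf.Subscheme
import Mathlib.AlgebraicGeometry.IdealSheaf.Functorial
import Mathlib.AlgebraicGeometry.Morphisms.ClosedImmersion
import HarnessLib

/-!
# RELATIVE EDITION (ring base `R`) — The seesaw closed subscheme, global vocabulary: «trivialised from the base» and affine-local representing ideals

RELATIVE EDITION of ★ `Motives/SeesawSubschemeReprIdeal` (port map `B-provers/B-p08/g11/PORTMAP-h8-RelativeSeesaw.B-p08g11.md`, file R6;
cell `hodgecm-mathlib`, F-DAG §5b hand (h8), author B-p08 (g11)): `SchemeOver ℂ ↦ SchemeOver R`; the two NAMED STATEMENTS become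
the ONE named statement `SeesawRelative.N1cDelta` (locality of «trivialised from the base» on the test scheme, DISCHARGED in the sequel
★-to-be `SeesawRelativeTrivFromBaseLocal.n1cDelta_holds`) quantified over all commutative rings `R` and all `X → Spec R` geometrically
integral and universally Stein (`UnivStein X`, ★ `SeesawRelativeChartSections`) — no properness, no field; the ★ global statement
`N1cLocal` is NOT re-declared (the relative chain takes the affine-local representing ideals as a LOCAL hypothesis, see
`SeesawRelativeSubschemeGlobal`); namespace
`Literature.AlgebraicGeometry.Motives.SeesawRelative`.  HC_CM is proved only modulo the 7 printed citations until rung 0 closes.  Original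
module docstring (with `ℂ` read as `R`):


[MumfordAV1970] §10 (p. 89) / [GortzWedhorn2023] Thm. 24.66, bookkeeping of the GLOBAL half of the scheme-theoretic
seesaw theorem for a module `𝓕` on `X × W` (`X`, `W` schemes over `ℂ`):
* `TrivFromBase X 𝓕 u` — for a test morphism `u : S → W`, `(1_X × u)^*𝓕 ≅ pr_S^*𝓜` for some rank-one quasi-coherent
  `𝓜` on `S` (the right-hand side of the universal property of the seesaw subscheme); stable under composition
  (`TrivFromBase.comp`) and restriction to opens of `S` (`TrivFromBase.restrict`, with the plumbing `openTest`/`restrictTest`);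
* `IsReprIdeal X 𝓕 U J` — on an affine open `U ⊆ W`, the ideal `J ⊆ Γ(W, U)` REPRESENTS: an affine test morphism
  landing in `U` is trivialised from the base iff it kills `J`; representing ideals are unique (`IsReprIdeal.unique`,
  tested on the quotient test schemes `Spec(Γ(W,U)/J′)`, §1) and restrict to basic opens (`IsReprIdeal.map_basicOpen`);
* the two statements the global half consumes, as named `Prop`s: `N1cLocal` (every affine open carries a
  representing ideal — the LOCAL seesaw mathematics, proved in `SeesawChartCover`) and `N1cDelta` («trivialised from the
  base» is Zariski-local on the test scheme, proved in `SeesawTrivFromBaseLocal`);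
* `app_eq_zero_of_forall_affineOpens`: sheaf locality of the comparison map `Γ(W, U) → Γ(S, u⁻¹U)`.
Generic in `X`, `W`, `𝓕` (cell `hodgecm-mathlib`, M13 node N1, file S1 of the split plan; HOME certificate
`B-plan/m13-glue/N1-Assembly.v9.B-p01g12.lean` 164baf9abb46c288, decls token-identical).

## References
* [MumfordAV1970] D. Mumford, *Abelian Varieties* (1970), §5 Cor. 6 (p. 51), §10 p. 89.
* [GortzWedhorn2023] U. Görtz, T. Wedhorn, *Algebraic Geometry II* (2023), Thm. 24.66 (p. 405; proof pp. 407–408).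
-/

set_option autoImplicit false

noncomputable section

universe u

open CategoryTheory CategoryTheory.Limits AlgebraicGeometry MonoidalCategory CartesianMonoidalCategory

namespace Literature.AlgebraicGeometry.Motives

namespace SeesawRelative

variable {R : Type} [CommRing R] (X : SchemeOver R) {W : SchemeOver R} (𝓕 : (X ⊗ W).left.Modules)

/-- **`(1 × u)^*𝓕` is trivialised from the base**: for a test morphism `u : S → W` over `R`, there is an
invertible quasi-coherent `𝓜` on `S` with `(1_X × u)^*𝓕 ≅ pr_S^*𝓜` — the right-hand side of the universal
property of the seesaw subscheme. [cite: MumfordAV1970, §10 (p. 89)] -/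
def TrivFromBase {S : SchemeOver R} (u : S ⟶ W) : Prop :=
  ∃ (𝓜 : S.left.Modules) (_ : 𝓜.IsQuasicoherent) (_ : HasRank 𝓜 1),
    Nonempty ((Scheme.Modules.pullback (X ◁ u).left).obj 𝓕 ≅
      (Scheme.Modules.pullback (CartesianMonoidalCategory.snd X S).left).obj 𝓜)

/-- **An affine-local representing ideal** on the affine open `U ⊆ W`: an ideal `J ⊆ Γ(W, U)` such that an
AFFINE test morphism `u : S → W` (any affine `R`-scheme `S`) with image in `U` has `(1 × u)^*𝓕` trivialised from
the base iff `J` is killed by `Γ(W, U) → Γ(S, u⁻¹U)`. [cite: MumfordAV1970, §10 (p. 89)] -/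
def IsReprIdeal (U : W.left.affineOpens) (J : Ideal Γ(W.left, U)) : Prop :=
  ∀ (S : SchemeOver R) [IsAffine S.left] (u : S ⟶ W),
    u.left ⁻¹ᵁ (U : W.left.Opens) = ⊤ →
      (TrivFromBase X 𝓕 u ↔ J ≤ RingHom.ker (u.left.app U).hom)


/-- **(1c-δ) — «trivialised from the base» is local on the test scheme** (statement; proved in
`SeesawTrivFromBaseLocal`): if every point of `S` has
an open neighbourhood `V` such that `(1 × u|_V)^*𝓕` is trivialised from the base, then so is `(1 × u)^*𝓕`
(the transition functions of the local trivialisations live in `Γ(X × V_{ij}, 𝒪)^× = Γ(V_{ij}, 𝒪)^×` by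
★ `snd_app_bijective_holds`, so they define an invertible `𝓜` on `S` with `(1 × u)^*𝓕 ≅ pr^*𝓜`).
[cite: MumfordAV1970, §5 Cor. 6 and §10 (p. 89)] -/
def N1cDelta : Prop :=
  ∀ {R : Type} [CommRing R] (X : SchemeOver R) [GeometricallyIntegral X.hom] (_ : UnivStein X)
    (W : SchemeOver R) (𝓕 : (X ⊗ W).left.Modules) [𝓕.IsQuasicoherent] (_ : HasRank 𝓕 1)
    (S : SchemeOver R) (u : S ⟶ W),
    (∀ s : S.left, ∃ (V : S.left.Opens), s ∈ V ∧
      TrivFromBase X 𝓕 (Over.homMk (V.ι ≫ u.left) (by rw [Category.assoc, Over.w u]; rfl) :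
        Over.mk (V.ι ≫ S.hom) ⟶ W)) →
    TrivFromBase X 𝓕 u


/-! ## §1 Quotient test schemes `Spec(Γ(W, U)/J′) → W` and the kernel of their comparison map -/


end SeesawRelative

namespace SeesawRelative

variable {R : Type} [CommRing R] {W : SchemeOver R} (U : W.left.affineOpens) (J' : Ideal Γ(W.left, U))

/-- The test morphism `Spec(Γ(W, U)/J′) → Spec Γ(W, U) ≅ U ⊆ W` (non-Prop plumbing). [folklore] -/
abbrev quotTestι : Spec (.of (Γ(W.left, U) ⧸ J')) ⟶ W.left :=
  Spec.map (CommRingCat.ofHom (Ideal.Quotient.mk J')) ≫ U.2.fromSpec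

/-- `Spec(Γ(W, U)/J′)` as a `R`-scheme through `W` (non-Prop plumbing). [folklore] -/
abbrev quotTest : SchemeOver R :=
  Over.mk (quotTestι U J' ≫ W.hom)

/-- The test morphism `Spec(Γ(W, U)/J′) → W` over `R` (non-Prop plumbing). [folklore] -/
abbrev quotTestHom : quotTest U J' ⟶ W :=
  Over.homMk (quotTestι U J') rfl

/-- The quotient test morphism lands in `U`. [cite: MumfordAV1970, §10 (p. 89)] -/
theorem quotTestι_preimage : quotTestι U J' ⁻¹ᵁ (U : W.left.Opens) = ⊤ := by
  rw [Scheme.Hom.comp_preimage, U.2.fromSpec_preimage_self]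
  rfl

/-- The restriction-to-`⊤` isomorphism behind `ker_quotTestι_app` (non-Prop plumbing). [folklore] -/
def quotTestIso : CommRingCat.of (Γ(W.left, U) ⧸ J') ⟶
    Γ(Spec (.of (Γ(W.left, U) ⧸ J')), quotTestι U J' ⁻¹ᵁ (U : W.left.Opens)) :=
  (Scheme.ΓSpecIso (.of (Γ(W.left, U) ⧸ J'))).inv ≫
    (Spec (.of (Γ(W.left, U) ⧸ J'))).presheaf.map (eqToHom (quotTestι_preimage U J')).op

/-- `quotTestIso` is an isomorphism (restriction to `⊤` and `Γ(Spec R) = R`). [folklore] -/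
instance : IsIso (quotTestIso U J') := by
  unfold quotTestIso; infer_instance

/-- The comparison map of the quotient test morphism on `U` is the quotient map followed by the
isomorphism `quotTestIso`. [cite: MumfordAV1970, §10 (p. 89)] -/
theorem quotTestι_app :
    (quotTestι U J').app U = CommRingCat.ofHom (Ideal.Quotient.mk J') ≫ quotTestIso U J' := by
  rw [quotTestIso, Scheme.Hom.comp_app, U.2.fromSpec_app_self, Category.assoc,
    Scheme.Hom.naturality, ← Category.assoc, ← Scheme.Hom.appTop]
  erw [← Scheme.ΓSpecIso_inv_naturality]
  simp only [eqToHom_op, eqToHom_unop, eqToHom_map]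
  exact Category.assoc _ _ _

/-- The comparison map `Γ(W, U) → Γ(Spec(Γ(W, U)/J′), ⊤)` of the quotient test morphism has kernel
exactly `J′`. [cite: MumfordAV1970, §10 (p. 89)] -/
theorem ker_quotTestι_app : RingHom.ker ((quotTestι U J').app U).hom = J' := by
  rw [quotTestι_app]
  have hinj : Function.Injective (quotTestIso U J').hom :=
    (ConcreteCategory.bijective_of_isIso (quotTestIso U J')).1
  ext x
  rw [RingHom.mem_ker]
  change (quotTestIso U J').hom (Ideal.Quotient.mk J' x) = 0 ↔ x ∈ J'
  rw [map_eq_zero_iff _ hinj, Ideal.Quotient.eq_zero_iff_mem]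

/-- The quotient test scheme is affine (instance on the abbreviation). [folklore] -/
instance : IsAffine (quotTest U J').left := inferInstanceAs (IsAffine (Spec _))

/-- The quotient test scheme is locally of finite type over `R` when `W` is. [folklore] -/
instance [LocallyOfFiniteType W.hom] : LocallyOfFiniteType (quotTest U J').hom := by
  change LocallyOfFiniteType ((Spec.map _ ≫ U.2.fromSpec) ≫ W.hom)
  have : LocallyOfFiniteType (Spec.map (CommRingCat.ofHom (Ideal.Quotient.mk J'))) := by
    rw [HasRingHomProperty.Spec_iff (P := @LocallyOfFiniteType)]
    exact RingHom.FiniteType.of_surjective _ Ideal.Quotient.mk_surjective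
  infer_instance

/-! ## §2 Representing ideals are unique and compatible with basic opens -/

variable (X : SchemeOver R) (𝓕 : (X ⊗ W).left.Modules)

variable {U} in
/-- Two representing ideals on the same affine open coincide (test with `Spec(Γ(W, U)/J′)`). [cite: MumfordAV1970, §10 (p. 89)] -/
theorem IsReprIdeal.le [LocallyOfFiniteType W.hom] {J J' : Ideal Γ(W.left, U)}
    (hJ : IsReprIdeal X 𝓕 U J) (hJ' : IsReprIdeal X 𝓕 U J') : J ≤ J' := by
  have h' : TrivFromBase X 𝓕 (quotTestHom U J') :=
    (hJ' (quotTest U J') (quotTestHom U J') (quotTestι_preimage U J')).2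
      (by change J' ≤ RingHom.ker ((quotTestι U J').app U).hom; rw [ker_quotTestι_app])
  have h := (hJ (quotTest U J') (quotTestHom U J') (quotTestι_preimage U J')).1 h'
  change J ≤ RingHom.ker ((quotTestι U J').app U).hom at h
  rwa [ker_quotTestι_app] at h

variable {U} in
/-- **Uniqueness of the representing ideal** on an affine open. [cite: MumfordAV1970, §10 (p. 89)] -/
theorem IsReprIdeal.unique [LocallyOfFiniteType W.hom] {J J' : Ideal Γ(W.left, U)}
    (hJ : IsReprIdeal X 𝓕 U J) (hJ' : IsReprIdeal X 𝓕 U J') : J = J' :=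
  le_antisymm (hJ.le X 𝓕 hJ') (hJ'.le X 𝓕 hJ)

variable {U} in
/-- **A representing ideal on `U` restricts to one on a basic open `D(f) ⊆ U`** (a test morphism landing
in `D(f)` lands in `U`, and the two comparison maps differ by restriction). [cite: MumfordAV1970, §10 (p. 89)] -/
theorem IsReprIdeal.map_basicOpen {J : Ideal Γ(W.left, U)} (hJ : IsReprIdeal X 𝓕 U J)
    (f : Γ(W.left, U)) :
    IsReprIdeal X 𝓕 (W.left.affineBasicOpen f)
      (J.map (W.left.presheaf.map (homOfLE (W.left.basicOpen_le f)).op).hom) := by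
  intro S _ u hu
  have hU : u.left ⁻¹ᵁ (U : W.left.Opens) = ⊤ :=
    top_le_iff.mp (hu ▸ (u.left.preimage_mono (W.left.basicOpen_le f)))
  rw [hJ S u hU, Ideal.map_le_iff_le_comap]
  -- the two kernels agree up to the restriction `Γ(W, U) → Γ(W, D(f))`
  suffices h : RingHom.ker (u.left.app U).hom =
      Ideal.comap (W.left.presheaf.map (homOfLE (W.left.basicOpen_le f)).op).hom
        (RingHom.ker (u.left.app (W.left.affineBasicOpen f)).hom) by rw [h]
  set k := (TopologicalSpace.Opens.map u.left.base).map (homOfLE (W.left.basicOpen_le f)) with hk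
  haveI : IsIso (S.left.presheaf.map k.op) := SeesawSubscheme.isIso_presheaf_map_of_eq_top hU hu k
  have hinj : Function.Injective (S.left.presheaf.map k.op).hom :=
    (ConcreteCategory.bijective_of_isIso _).1
  have hnat := u.left.naturality (homOfLE (W.left.basicOpen_le f)).op
  ext x
  have hx := congrArg (fun φ => φ.hom x) hnat
  simp only [Quiver.Hom.unop_op, CommRingCat.hom_comp, RingHom.comp_apply] at hx
  simp only [RingHom.mem_ker, Ideal.mem_comap]
  constructor
  · intro h0
    rw [h0, map_zero] at hx
    exact hx
  · intro h0
    apply hinj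
    rw [← hk] at hx
    rw [map_zero, ← hx]
    exact h0

end SeesawRelative

/-! ## §4 «Trivialised from the base» is stable under composition of test morphisms -/

namespace SeesawRelative

variable {R : Type} [CommRing R] (X : SchemeOver R) {W : SchemeOver R} (𝓕 : (X ⊗ W).left.Modules)

/-- If `(1 × u)^*𝓕 ≅ pr^*𝓜` then `(1 × (j ≫ u))^*𝓕 ≅ pr^*(j^*𝓜)`. [cite: MumfordAV1970, §10 (p. 89)] -/
theorem TrivFromBase.comp {S S' : SchemeOver R} (j : S' ⟶ S) {u : S ⟶ W}
    (h : TrivFromBase X 𝓕 u) : TrivFromBase X 𝓕 (j ≫ u) := by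
  obtain ⟨𝓜, h𝓜q, h𝓜1, ⟨e⟩⟩ := h
  refine ⟨(Scheme.Modules.pullback j.left).obj 𝓜, Modules.isQuasicoherent_pullback _ _,
    Modules.hasRank_pullback _ h𝓜1, ⟨?_⟩⟩
  have h1 : (X ◁ (j ≫ u)).left = (X ◁ j).left ≫ (X ◁ u).left := by
    rw [MonoidalCategory.whiskerLeft_comp]; rfl
  have h2 : (X ◁ j).left ≫ (CartesianMonoidalCategory.snd X S).left =
      (CartesianMonoidalCategory.snd X S').left ≫ j.left := by
    rw [← Over.comp_left, ← Over.comp_left, CartesianMonoidalCategory.whiskerLeft_snd]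
  exact (Scheme.Modules.pullbackCongr h1).app 𝓕 ≪≫
    ((Scheme.Modules.pullbackComp (X ◁ j).left (X ◁ u).left).symm.app 𝓕) ≪≫
    (Scheme.Modules.pullback (X ◁ j).left).mapIso e ≪≫
    (Scheme.Modules.pullbackComp (X ◁ j).left (CartesianMonoidalCategory.snd X S).left).app 𝓜 ≪≫
    (Scheme.Modules.pullbackCongr h2).app 𝓜 ≪≫
    (Scheme.Modules.pullbackComp (CartesianMonoidalCategory.snd X S').left j.left).symm.app 𝓜

end SeesawRelative

/-! ## §5 Restricting a test morphism to an open of the test scheme -/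

namespace SeesawRelative

variable {R : Type} [CommRing R] (X : SchemeOver R) {W : SchemeOver R} (𝓕 : (X ⊗ W).left.Modules)

/-- The open piece `V ⊆ S` as a `R`-scheme (non-Prop plumbing). [folklore] -/
abbrev openTest {S : SchemeOver R} (V : S.left.Opens) : SchemeOver R :=
  Over.mk (V.ι ≫ S.hom)

/-- The inclusion `V ⊆ S` over `R` (non-Prop plumbing). [folklore] -/
abbrev openTestι {S : SchemeOver R} (V : S.left.Opens) : openTest V ⟶ S :=
  Over.homMk V.ι rfl

/-- The restricted test morphism `V ⊆ S → W` (non-Prop plumbing). [folklore] -/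
def restrictTest {S : SchemeOver R} (V : S.left.Opens) (u : S ⟶ W) : openTest V ⟶ W :=
  Over.homMk (V.ι ≫ u.left) (by rw [Category.assoc, Over.w u]; rfl)

/-- Underlying morphism of the restricted test morphism. [cite: MumfordAV1970, §10 (p. 89)] -/
@[simp]
theorem restrictTest_left {S : SchemeOver R} (V : S.left.Opens) (u : S ⟶ W) :
    (restrictTest V u).left = V.ι ≫ u.left := rfl

/-- An open piece of a locally-finite-type `R`-scheme is locally of finite type. [folklore] -/
instance {S : SchemeOver R} [LocallyOfFiniteType S.hom] (V : S.left.Opens) :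
    LocallyOfFiniteType (openTest V).hom :=
  inferInstanceAs (LocallyOfFiniteType (V.ι ≫ S.hom))

/-- `(V ⊆ S) ≫ u` is the restricted test morphism. [cite: MumfordAV1970, §10 (p. 89)] -/
theorem openTestι_comp {S : SchemeOver R} (V : S.left.Opens) (u : S ⟶ W) :
    openTestι V ≫ u = restrictTest V u := by
  ext : 1
  simp [restrictTest]

/-- Restricting a trivialised test morphism to an open keeps it trivialised. [cite: MumfordAV1970, §10 (p. 89)] -/
theorem TrivFromBase.restrict {S : SchemeOver R} (V : S.left.Opens) {u : S ⟶ W}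
    (h : TrivFromBase X 𝓕 u) : TrivFromBase X 𝓕 (restrictTest V u) := by
  rw [← openTestι_comp]
  exact h.comp X 𝓕 (openTestι V)

/-- A restricted test morphism lands in `U` as soon as `V ⊆ u⁻¹U`. [cite: MumfordAV1970, §10 (p. 89)] -/
theorem preimage_restrictTest_eq_top {S : SchemeOver R} {V : S.left.Opens} {u : S ⟶ W}
    {U : W.left.Opens} (hV : V ≤ u.left ⁻¹ᵁ U) : (restrictTest V u).left ⁻¹ᵁ U = ⊤ := by
  change V.ι ⁻¹ᵁ (u.left ⁻¹ᵁ U) = ⊤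
  exact top_le_iff.mp (V.ι_preimage_self.symm.le.trans (V.ι.preimage_mono hV))

/-- The comparison map of the restricted test morphism is the original one followed by restriction,
so its kernel contains the original kernel. [cite: MumfordAV1970, §10 (p. 89)] -/
theorem ker_app_le_ker_restrictTest_app {S : SchemeOver R} (V : S.left.Opens) (u : S ⟶ W)
    (U : W.left.Opens) :
    RingHom.ker (u.left.app U).hom ≤ RingHom.ker ((restrictTest V u).left.app U).hom := by
  intro x hx
  rw [RingHom.mem_ker] at hx ⊢
  change (V.ι.app (u.left ⁻¹ᵁ U)).hom ((u.left.app U).hom x) = 0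
  rw [hx, map_zero]

/-- **Locality of the comparison map on the test scheme**: a section of `Γ(W, U)` whose image dies on
every affine open `V ⊆ u⁻¹U` of the (affine) test scheme dies in `Γ(S, u⁻¹U)`. [cite: MumfordAV1970, §10 (p. 89)] -/
theorem app_eq_zero_of_forall_affineOpens {S : SchemeOver R} (u : S ⟶ W) (U : W.left.Opens)
    (x : Γ(W.left, U))
    (h : ∀ V : S.left.affineOpens, (V : S.left.Opens) ≤ u.left ⁻¹ᵁ U →
      ((restrictTest (V : S.left.Opens) u).left.app U).hom x = 0) :
    (u.left.app U).hom x = 0 := by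
  -- the affine opens below `u⁻¹U`, embedded as `V ∩ u⁻¹U = V.ι(V.ι⁻¹(u⁻¹U))`
  let ι' := {V : S.left.affineOpens // (V : S.left.Opens) ≤ u.left ⁻¹ᵁ U}
  let O : ι' → S.left.Opens := fun V => (V.1 : S.left.Opens).ι ''ᵁ (V.1 : S.left.Opens).ι ⁻¹ᵁ (u.left ⁻¹ᵁ U)
  have hO : ∀ V : ι', O V ≤ u.left ⁻¹ᵁ U := fun V => by
    simp only [O, Scheme.Hom.image_preimage_eq_opensRange_inf]
    exact inf_le_right
  have hcover : u.left ⁻¹ᵁ U ≤ iSup O := by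
    intro s hs
    obtain ⟨V', hV', hsV', hV'U⟩ := exists_isAffineOpen_mem_and_subset hs
    refine TopologicalSpace.Opens.mem_iSup.mpr ⟨⟨⟨V', hV'⟩, hV'U⟩, ?_⟩
    simp only [O, Scheme.Hom.image_preimage_eq_opensRange_inf, Scheme.Opens.opensRange_ι]
    exact ⟨hsV', hs⟩
  refine S.left.sheaf.eq_of_locally_eq' O (u.left ⁻¹ᵁ U) (fun V => homOfLE (hO V)) hcover
    ((u.left.app U).hom x) 0 fun V => ?_
  have h1 := h V.1 V.2
  change (S.left.presheaf.map (homOfLE (hO V)).op).hom ((u.left.app U).hom x) =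
    (S.left.presheaf.map (homOfLE (hO V)).op).hom 0
  rw [map_zero]
  exact h1

end SeesawRelative

end Literature.AlgebraicGeometry.Motives

end
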